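import Summits.BirchSwinnertonDyer.BirchSwinnertonDyer.Theorems.ByReductionTypeAtTwoRankOneSprungEtaBridgeAtTwo
import Literature.NumberTheory.EllipticCurves.FormalGroupDictionaryProofs
import Literature.NumberTheory.EllipticCurves.UniversalSigmaSpecializationProofs
import HarnessLib

/-!
# The ♯/♭ ↔ η dictionary, HALVES and the Katz-column dialects: under the bridge `‖Λ_η‖ = ¼‖PR‖` the Kato half K2-Kss is the Kato half
# 56A-K and the lower half K2-Lss is 56A-L, curve by curve; and an -es Katz Frobenius column is an -an Katz column (all PROVED)

Cell `bsd-f1-sign2`, seat `-an` g52 (MEMO-an §56.10), crux `stmt-BirchSwinnertonDyer-23715`; helper file, closes nothing, asserts nothing new.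
Companion of `…Theorems.ByReductionTypeAtTwoRankOneSharpFlatEtaDictionaryAtTwo` (the EQUALITY case `K2-Vss ⟺ 56A`).

* `norm_le_iff_valuation_le` — in `ℚ_[p]`, for non-zero `x, y`: `‖x‖ ≤ ‖y‖ ↔ v(y) ≤ v(x)`.
* `valuation_etaSide`, `valuation_arithSide` — the valuations of the two sides `ϖ·Λ·m²` and `s·lg²·t` of the η-identities
  (`v(Λ) = v(PR) + 2` from the bridge instance; `m` odd; `v(lg) = ℓ`).
* `etaNorm_le_iff_prValuation_ge` / `etaNorm_ge_iff_prValuation_le` — pure-`ℚ₂` halves.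
* `twoAdicKatoBound_iff_perrinRiouKatoHalf` — THE KATO HALVES AGREE: for a curve `W` with shared data, under the B56 instance, `PR ≠ 0`,
  `ϖ ≠ 0`, `log_ω(P) ≠ 0`, odd `#tors`, `Tam ≠ 0`, `Ш[2^∞]` finite and the log-symbol compatibility `padicLogOrd W 2 ι P = v₂(log_ω P)`
  (PROVED in `…LogCompatAtTwo`, a binder here only for build-snapshot reasons): the K2-Kss inequality
  `‖ϖ·Λ_η·#tors²‖ ≤ ‖#Ш[2^∞]·log_ω(P)²·Tam‖` (`Rank1Residual.F1Sign2.TwoAdicKatoBoundEtaRankOneSs`, -es) holds IFF the 56A-K inequality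
  `v₂#Ш[2^∞] + v₂Tam − v₂ϖ + 2·padicLogOrd − 2 ≤ v₂(PR)` (`PerrinRiouKatoHalfAtTwo`, -an) holds; `twoAdicLowerBound_iff_perrinRiouLowerHalf` —
  the same for K2-Lss / 56A-L.  STAFFING CONSEQUENCE (MEMO-an §56.10, MEMO-es §16): one Kato half for the supersingular slice of 23715, not two.
* `isKatzColumnAtTwo_of_isKatzFrobeniusColumn` — the -es receptacle `IsKatzFrobeniusColumn W 2 u v` (`∃ c₁ c₂ …`, rows over `ℚ` cast to `ℚ₂`)
  implies the -an receptacle `IsKatzColumnAtTwo W u v` (D51-K, rows over `W.map (algebraMap ℚ ℚ₂)`): `u/v = −c₁`, `2/v = 2c₂`, and `ω`, `x·w²`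
  commute with base change (`map_formalOmega`, `map_formalXMulSq`).  This removes the "Katz dialect" item from the list of what separates the
  closed `Prop`s 56A and K2-Vss (remaining: `plusPeriod f ≠ 0` — tree `IsNewform0.plusPeriod_pos_holds` — and the non-degeneracy inputs).
BSD is not proved by any of this; 23715 is not closed.  References: [cite: Kato2004, Thm. 12.5] [cite: KuriharaPollack2007, (9)–(11)]
[cite: Katz1981CrysCohDieudonne, §5.1] [cite: SilvermanAEC2009, IV.1.1].
-/

set_option linter.unusedSectionVars false

namespace Summit.BirchSwinnertonDyer.BirchSwinnertonDyer.Theorems.PerrinRiouElementAtTwo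

open scoped Classical MatrixGroups ModularForm
open CongruenceSubgroup PowerSeries WeierstrassCurve Literature.NumberTheory.EllipticCurves Literature.NumberTheory.EllipticCurves.ModularForms
  Literature.NumberTheory.EllipticCurves.Sprung2017 Literature.NumberTheory.EllipticCurves.Rank1Residual
  Summit.BirchSwinnertonDyer.Rank1Residual.F1Sign2

/-! ### §1 Pure `ℚ_p` bookkeeping (inequalities) -/

/-- In `ℚ_[p]`, for non-zero `x, y`: `‖x‖ ≤ ‖y‖ ↔ v(y) ≤ v(x)`. [folklore] -/
theorem norm_le_iff_valuation_le {p : ℕ} [Fact p.Prime] {x y : ℚ_[p]} (hx : x ≠ 0) (hy : y ≠ 0) :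
    ‖x‖ ≤ ‖y‖ ↔ y.valuation ≤ x.valuation := by
  rw [Padic.norm_eq_zpow_neg_valuation hx, Padic.norm_eq_zpow_neg_valuation hy]
  have hp1 : (1 : ℝ) < p := by exact_mod_cast (Fact.out : p.Prime).one_lt
  rw [zpow_le_zpow_iff_right₀ hp1]
  omega

/-- Valuation of the η side `ϖ·Λ·m²` under the bridge instance `‖Λ‖ = ¼‖PR‖` (`PR ≠ 0`, `ϖ ≠ 0`, `m` odd): non-zero, of valuation
`v(ϖ) + v(PR) + 2`. [folklore] -/
theorem valuation_etaSide {Λ PR : ℚ_[2]} {ϖ : ℚ} {m : ℕ} (hbr : ‖Λ‖ = 4⁻¹ * ‖PR‖) (hPR : PR ≠ 0) (hϖ : ϖ ≠ 0) (hm : Odd m) :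
    (ϖ : ℚ_[2]) * Λ * (m : ℚ_[2]) ^ 2 ≠ 0 ∧
      ((ϖ : ℚ_[2]) * Λ * (m : ℚ_[2]) ^ 2).valuation = padicValRat 2 ϖ + PR.valuation + 2 := by
  obtain ⟨hΛ0, hΛv⟩ := valuation_eq_add_two_of_norm_eq hPR hbr
  have hϖ0 : (ϖ : ℚ_[2]) ≠ 0 := by exact_mod_cast hϖ
  have hm0' : m ≠ 0 := by rintro rfl; exact absurd hm (by decide)
  have hm0 : (m : ℚ_[2]) ≠ 0 := by exact_mod_cast hm0'
  have hvm : (m : ℚ_[2]).valuation = 0 := by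
    rw [Padic.valuation_natCast]
    have : padicValNat 2 m = 0 := padicValNat.eq_zero_of_not_dvd (by obtain ⟨j, hj⟩ := hm; omega)
    exact_mod_cast this
  refine ⟨mul_ne_zero (mul_ne_zero hϖ0 hΛ0) (pow_ne_zero _ hm0), ?_⟩
  rw [Padic.valuation_mul (mul_ne_zero hϖ0 hΛ0) (pow_ne_zero _ hm0), Padic.valuation_mul hϖ0 hΛ0, Padic.valuation_pow, hvm, hΛv,
    Padic.valuation_ratCast]
  ring

/-- Valuation of the arithmetic side `s·lg²·t` (`s, t ≠ 0` naturals, `lg ≠ 0` of valuation `ℓ`): non-zero, of valuation `v s + 2ℓ + v t`.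
[folklore] -/
theorem valuation_arithSide {lg : ℚ_[2]} {s t : ℕ} {ℓ : ℤ} (hs : s ≠ 0) (ht : t ≠ 0) (hlg : lg ≠ 0) (hℓ : lg.valuation = ℓ) :
    (s : ℚ_[2]) * lg ^ 2 * (t : ℚ_[2]) ≠ 0 ∧
      ((s : ℚ_[2]) * lg ^ 2 * (t : ℚ_[2])).valuation = (padicValNat 2 s : ℤ) + 2 * ℓ + (padicValNat 2 t : ℤ) := by
  have hs0 : (s : ℚ_[2]) ≠ 0 := by exact_mod_cast hs
  have ht0 : (t : ℚ_[2]) ≠ 0 := by exact_mod_cast ht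
  refine ⟨mul_ne_zero (mul_ne_zero hs0 (pow_ne_zero _ hlg)) ht0, ?_⟩
  rw [Padic.valuation_mul (mul_ne_zero hs0 (pow_ne_zero _ hlg)) ht0, Padic.valuation_mul hs0 (pow_ne_zero _ hlg), Padic.valuation_pow,
    hℓ, Padic.valuation_natCast, Padic.valuation_natCast]
  push_cast
  ring

/-- Pure-`ℚ₂` Kato half: `‖ϖ·Λ·m²‖ ≤ ‖s·lg²·t‖ ↔ v s + v t − v ϖ + 2ℓ − 2 ≤ v(PR)`. [folklore] -/
theorem etaNorm_le_iff_prValuation_ge {Λ PR lg : ℚ_[2]} {ϖ : ℚ} {s t m : ℕ} {ℓ : ℤ}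
    (hbr : ‖Λ‖ = 4⁻¹ * ‖PR‖) (hPR : PR ≠ 0) (hϖ : ϖ ≠ 0) (hs : s ≠ 0) (ht : t ≠ 0) (hm : Odd m)
    (hlg : lg ≠ 0) (hℓ : lg.valuation = ℓ) :
    ‖(ϖ : ℚ_[2]) * Λ * (m : ℚ_[2]) ^ 2‖ ≤ ‖(s : ℚ_[2]) * lg ^ 2 * (t : ℚ_[2])‖ ↔
      (padicValNat 2 s : ℤ) + (padicValNat 2 t : ℤ) - padicValRat 2 ϖ + 2 * ℓ - 2 ≤ PR.valuation := by
  obtain ⟨hL0, hLv⟩ := valuation_etaSide hbr hPR hϖ hm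
  obtain ⟨hR0, hRv⟩ := valuation_arithSide hs ht hlg hℓ
  rw [norm_le_iff_valuation_le hL0 hR0, hLv, hRv]
  constructor <;> intro h <;> linarith

/-- Pure-`ℚ₂` lower half: `‖s·lg²·t‖ ≤ ‖ϖ·Λ·m²‖ ↔ v(PR) ≤ v s + v t − v ϖ + 2ℓ − 2`. [folklore] -/
theorem etaNorm_ge_iff_prValuation_le {Λ PR lg : ℚ_[2]} {ϖ : ℚ} {s t m : ℕ} {ℓ : ℤ}
    (hbr : ‖Λ‖ = 4⁻¹ * ‖PR‖) (hPR : PR ≠ 0) (hϖ : ϖ ≠ 0) (hs : s ≠ 0) (ht : t ≠ 0) (hm : Odd m)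
    (hlg : lg ≠ 0) (hℓ : lg.valuation = ℓ) :
    ‖(s : ℚ_[2]) * lg ^ 2 * (t : ℚ_[2])‖ ≤ ‖(ϖ : ℚ_[2]) * Λ * (m : ℚ_[2]) ^ 2‖ ↔
      PR.valuation ≤ (padicValNat 2 s : ℤ) + (padicValNat 2 t : ℤ) - padicValRat 2 ϖ + 2 * ℓ - 2 := by
  obtain ⟨hL0, hLv⟩ := valuation_etaSide hbr hPR hϖ hm
  obtain ⟨hR0, hRv⟩ := valuation_arithSide hs ht hlg hℓ
  rw [norm_le_iff_valuation_le hR0 hL0, hLv, hRv]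
  constructor <;> intro h <;> linarith

/-! ### §2 The halves agree on curve data -/

section Curve

variable (W : WeierstrassCurve ℚ) [W.IsElliptic] [W.IsGloballyMinimal]
  {Lsharp Lflat : IwasawaAlgebra 2} {L : Fin 2 → ℚ_[2]} {v : ℚ_[2]} {ϖ : ℚ} (ι : ℚ →+* ℚ_[2]) (P : W.toAffine.Point)

/-- **K2-Kss ⟺ 56A-K curve by curve** (the Kato halves of the two currencies agree under the bridge instance and non-degeneracy).
[folklore] -/
theorem twoAdicKatoBound_iff_perrinRiouKatoHalf
    (hbr : ‖ssLeadingEta W 2 L v‖ = 4⁻¹ * ‖prComb (W.frobeniusTrace 2) Lsharp Lflat‖)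
    (hPR : prComb (W.frobeniusTrace 2) Lsharp Lflat ≠ 0) (hϖ : ϖ ≠ 0) (hT : Odd W.torsionOrder) (hTam : W.tamagawaProduct ≠ 0)
    (hfin : Finite (AddCommGroup.primaryComponent W.sha 2)) (hlog : logOmegaAt W 2 P ≠ 0)
    (hℓ : padicLogOrd W 2 ι (K := ℚ) P = (logOmegaAt W 2 P).valuation) :
    ‖(ϖ : ℚ_[2]) * ssLeadingEta W 2 L v * (W.torsionOrder : ℚ_[2]) ^ 2‖ ≤
        ‖(Nat.card (AddCommGroup.primaryComponent W.sha 2) : ℚ_[2]) * (logOmegaAt W 2 P) ^ 2 * W.tamagawaProduct‖ ↔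
      (padicValNat 2 (Nat.card (AddCommGroup.primaryComponent W.sha 2)) : ℤ) +
          (padicValNat 2 W.tamagawaProduct : ℤ) - padicValRat 2 ϖ + 2 * padicLogOrd W 2 ι (K := ℚ) P - 2 ≤
        (prComb (W.frobeniusTrace 2) Lsharp Lflat).valuation := by
  haveI := hfin
  have hs : Nat.card (AddCommGroup.primaryComponent W.sha 2) ≠ 0 := Nat.card_pos.ne'
  exact etaNorm_le_iff_prValuation_ge hbr hPR hϖ hs hTam hT hlog hℓ.symm

/-- **K2-Lss ⟺ 56A-L curve by curve.** [folklore] -/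
theorem twoAdicLowerBound_iff_perrinRiouLowerHalf
    (hbr : ‖ssLeadingEta W 2 L v‖ = 4⁻¹ * ‖prComb (W.frobeniusTrace 2) Lsharp Lflat‖)
    (hPR : prComb (W.frobeniusTrace 2) Lsharp Lflat ≠ 0) (hϖ : ϖ ≠ 0) (hT : Odd W.torsionOrder) (hTam : W.tamagawaProduct ≠ 0)
    (hfin : Finite (AddCommGroup.primaryComponent W.sha 2)) (hlog : logOmegaAt W 2 P ≠ 0)
    (hℓ : padicLogOrd W 2 ι (K := ℚ) P = (logOmegaAt W 2 P).valuation) :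
    ‖(Nat.card (AddCommGroup.primaryComponent W.sha 2) : ℚ_[2]) * (logOmegaAt W 2 P) ^ 2 * W.tamagawaProduct‖ ≤
        ‖(ϖ : ℚ_[2]) * ssLeadingEta W 2 L v * (W.torsionOrder : ℚ_[2]) ^ 2‖ ↔
      (prComb (W.frobeniusTrace 2) Lsharp Lflat).valuation ≤
        (padicValNat 2 (Nat.card (AddCommGroup.primaryComponent W.sha 2)) : ℤ) +
          (padicValNat 2 W.tamagawaProduct : ℤ) - padicValRat 2 ϖ + 2 * padicLogOrd W 2 ι (K := ℚ) P - 2 := by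
  haveI := hfin
  have hs : Nat.card (AddCommGroup.primaryComponent W.sha 2) ≠ 0 := Nat.card_pos.ne'
  exact etaNorm_ge_iff_prValuation_le hbr hPR hϖ hs hTam hT hlog hℓ.symm

end Curve

/-! ### §3 The Katz-column dialects: -es `IsKatzFrobeniusColumn W 2` ⟹ -an `IsKatzColumnAtTwo` -/

/-- **An -es Katz Frobenius column is an -an (D51-K) Katz column** (same `u, v`): `u/v = −c₁`, `2/v = 2c₂`, and `ω`, `x·w²` commute with the
base change `ℚ → ℚ₂`. [cite: Katz1981CrysCohDieudonne, §5.1] -/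
theorem isKatzColumnAtTwo_of_isKatzFrobeniusColumn (W : WeierstrassCurve ℚ) {u v : ℚ_[2]} (h : IsKatzFrobeniusColumn W 2 u v) :
    IsKatzColumnAtTwo W u v := by
  obtain ⟨c₁, c₂, hc₂, hv, hu, hrows⟩ := h
  have hv0 : v ≠ 0 := by rw [hv]; exact inv_ne_zero hc₂
  refine ⟨hv0, fun n hn => ?_⟩
  have hn0 : (n : ℚ_[2]) ≠ 0 := by exact_mod_cast (show n ≠ 0 by omega)
  have huv : u / v = -c₁ := by rw [hu, hv]; field_simp
  have h2v : (2 : ℚ_[2]) / v = 2 * c₂ := by rw [hv, div_inv_eq_mul]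
  set φ : ℚ →+* ℚ_[2] := algebraMap ℚ ℚ_[2] with hφ
  have hφq : ∀ q : ℚ, φ q = (q : ℚ_[2]) := fun q => eq_ratCast φ q
  have hΩ : (W.map φ).formalOmega = PowerSeries.map φ W.formalOmega := (WeierstrassCurve.map_formalOmega φ W).symm
  have hX : (W.map φ).formalXMulSq = PowerSeries.map φ W.formalXMulSq := (W.map_formalXMulSq φ).symm
  have hprod : (W.map φ).formalOmega * (W.map φ).formalXMulSq = PowerSeries.map φ (W.formalXMulSq * W.formalOmega) := by
    rw [hΩ, hX, ← map_mul, mul_comm]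
  rw [norm_div, div_le_one (norm_pos_iff.mpr hn0), hprod, hΩ, PowerSeries.coeff_map, PowerSeries.coeff_map, huv, h2v]
  have key : φ (coeff (n + 1) (W.formalXMulSq * W.formalOmega)) + -c₁ * φ (coeff (n - 1) W.formalOmega) -
        2 * c₂ * (if 2 ∣ n then coeff (n / 2 - 1) (PowerSeries.map φ W.formalOmega) else 0) =
      ((coeff (n + 1) (W.formalXMulSq * W.formalOmega) : ℚ) : ℚ_[2]) - c₁ * ((coeff (n - 1) W.formalOmega : ℚ) : ℚ_[2]) -
        (if 2 ∣ n then ((2 : ℕ) : ℚ_[2]) * c₂ * ((coeff (n / 2 - 1) W.formalOmega : ℚ) : ℚ_[2]) else 0) := by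
    split_ifs with h2
    · rw [PowerSeries.coeff_map, hφq, hφq, hφq]; push_cast; ring
    · rw [hφq, hφq]; ring
  rw [key]
  exact hrows n (by omega)

end Summit.BirchSwinnertonDyer.BirchSwinnertonDyer.Theorems.PerrinRiouElementAtTwo
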